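import Mathlib
import Literature.Analysis.FluidPDE.VectorCalculus

/-!
# `SkeletonEquilibrium` (stmt-NavierStokesRegularity-15400), line `Sketch`: the forced slope law

Tools stub `stub_forcedSlopeLaw` of the lead skeleton. Far from the waist each filament of the
relative equilibrium solves, in the rescaled variable, the unit-speed profile equation with forcing
`X″ = η X′ × (V(X) + U(t))`, where `V y = ½ y − α e₃ × y` is the rotating Leray drift
(`e₃ = EuclideanSpace.single 2 1`) and `U` is the non-local velocity. The drift slip
`g(t) = ⟪X′(t), V(X(t))⟫` then satisfies the EXACT identity
`g′ = ½ − η ⟪U, X′ × V(X)⟫`: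
by the product rule `g′ = ⟪X′, V(X′)⟫ + ⟪X″, V(X)⟫`; the first term is
`½‖X′‖² − α⟪X′, e₃ × X′⟫ = ½`, and the second is
`η⟪X′ × V(X), V(X)⟫ + η⟪X′ × U, V(X)⟫ = 0 − η⟪U, X′ × V(X)⟫` (scalar triple product).
The unforced case `U = 0` is the sibling `stub_outerSlopeHalf`.
-/

noncomputable section

namespace Summit.NavierStokesRegularity.NavierStokesRegularity.Theorems.SkeletonEquilibrium.Sketch
set_option linter.dupNamespace false

open Literature.Analysis.FluidPDE
open scoped RealInnerProductSpace InnerProductSpace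

/-- `⟪a × b, b⟫ = 0`: a cross product is orthogonal to its second factor (coordinate expansion of
Mathlib's `crossProduct` transported to `EuclideanSpace ℝ (Fin 3)`; also in …OuterSlopeHalf, private there).
[folklore] -/
private theorem inner_cross_self_right (a b : EuclideanSpace ℝ (Fin 3)) : ⟪cross a b, b⟫ = 0 := by
  simp only [cross, PiLp.inner_apply, RCLike.inner_apply, conj_trivial, Fin.sum_univ_three,
    cross_apply, Matrix.cons_val_zero, Matrix.cons_val_one, Matrix.cons_val_two,
    Matrix.head_cons, Matrix.tail_cons]
  ring

/-- `⟪b, a × b⟫ = 0`: a cross product is orthogonal to its second factor (symmetric form of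
`inner_cross_self_right`; also in …OuterSlopeHalf, private there). [folklore] -/
private theorem inner_self_cross_right (a b : EuclideanSpace ℝ (Fin 3)) : ⟪b, cross a b⟫ = 0 := by
  rw [real_inner_comm]
  exact inner_cross_self_right a b

/-- Scalar triple product antisymmetry `⟪a × b, c⟫ = −⟪b, a × c⟫` on `EuclideanSpace ℝ (Fin 3)`
(coordinate expansion of Mathlib's `crossProduct`). [folklore] -/
private theorem inner_cross_left_eq_neg (a b c : EuclideanSpace ℝ (Fin 3)) :
    ⟪cross a b, c⟫ = -⟪b, cross a c⟫ := by
  simp only [cross, PiLp.inner_apply, RCLike.inner_apply, conj_trivial, Fin.sum_univ_three,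
    cross_apply, Matrix.cons_val_zero, Matrix.cons_val_one, Matrix.cons_val_two,
    Matrix.head_cons, Matrix.tail_cons]
  ring

/-- Additivity of the cross product in its second factor, `a × (b + c) = a × b + a × c`
(linearity of `crossCLM a`). [folklore] -/
private theorem cross_add_right (a b c : EuclideanSpace ℝ (Fin 3)) :
    cross a (b + c) = cross a b + cross a c := by
  show crossCLM a (b + c) = crossCLM a b + crossCLM a c
  exact map_add _ _ _

/-- The drift `½ X − α e₃ × X` along a differentiable curve has derivative `½ X′ − α e₃ × X′`
(linearity of `y ↦ ½ y − α e₃ × y`, bundled through `crossCLM`; also in …OuterSlopeHalf, private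
there). [folklore] -/
private theorem hasDerivAt_drift {α : ℝ} {Y : ℝ → EuclideanSpace ℝ (Fin 3)}
    {T : EuclideanSpace ℝ (Fin 3)} {s : ℝ} (hY : HasDerivAt Y T s) :
    HasDerivAt
      (fun σ => (1 / 2 : ℝ) • Y σ - α • cross (EuclideanSpace.single (2 : Fin 3) (1 : ℝ)) (Y σ))
      ((1 / 2 : ℝ) • T - α • cross (EuclideanSpace.single (2 : Fin 3) (1 : ℝ)) T) s := by
  set L : EuclideanSpace ℝ (Fin 3) →L[ℝ] EuclideanSpace ℝ (Fin 3) :=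
    (1 / 2 : ℝ) • ContinuousLinearMap.id ℝ _ -
      α • crossCLM (EuclideanSpace.single (2 : Fin 3) (1 : ℝ)) with hL
  have hLapp : ∀ y, L y =
      (1 / 2 : ℝ) • y - α • cross (EuclideanSpace.single (2 : Fin 3) (1 : ℝ)) y :=
    fun y => by simp [hL, crossCLM_apply]
  have h := L.hasFDerivAt.comp_hasDerivAt s hY
  have hfun : (fun σ => (1 / 2 : ℝ) • Y σ -
      α • cross (EuclideanSpace.single (2 : Fin 3) (1 : ℝ)) (Y σ)) = L ∘ Y := by
    funext σ; simp [hLapp]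
  rw [hfun, ← hLapp]
  exact h

/-- The pointwise algebra of the forced slope law: for a unit vector `a` (the tangent), a point `y`
and a forcing vector `u`, with `v = ½ y − α e₃ × y`,
`⟪a, ½ a − α e₃ × a⟫ + ⟪η a × (v + u), v⟫ = ½ − η ⟪u, a × v⟫`
(`‖a‖ = 1`, `⟪a, e₃ × a⟫ = 0`, `⟪a × v, v⟫ = 0`, `⟪a × u, v⟫ = −⟪u, a × v⟫`). [folklore] -/
private theorem slope_algebra (η α : ℝ) (a y u : EuclideanSpace ℝ (Fin 3)) (ha : ‖a‖ = 1) :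
    ⟪a, (1 / 2 : ℝ) • a - α • cross (EuclideanSpace.single (2 : Fin 3) (1 : ℝ)) a⟫ +
      ⟪η • cross a ((1 / 2 : ℝ) • y - α • cross (EuclideanSpace.single (2 : Fin 3) (1 : ℝ)) y + u),
        (1 / 2 : ℝ) • y - α • cross (EuclideanSpace.single (2 : Fin 3) (1 : ℝ)) y⟫ =
      1 / 2 - η * ⟪u, cross a ((1 / 2 : ℝ) • y -
        α • cross (EuclideanSpace.single (2 : Fin 3) (1 : ℝ)) y)⟫ := by
  rw [inner_sub_right, real_inner_smul_right, real_inner_smul_right, real_inner_self_eq_norm_sq,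
    ha, inner_self_cross_right, real_inner_smul_left, cross_add_right, inner_add_left,
    inner_cross_self_right, inner_cross_left_eq_neg]
  ring

/-- **Forced slope law (HasDerivAt form).** For a `C²` unit-speed solution of
`X″ = η X′ × (½ X − α e₃ × X + U)` the drift slip `s ↦ ⟪X′ s, ½ X s − α e₃ × X s⟫` has derivative
`½ − η ⟪U t, X′ t × (½ X t − α e₃ × X t)⟫` at every `t` (product rule `HasDerivAt.inner`, the
drift derivative `hasDerivAt_drift`, `X″ = deriv (deriv X) = iteratedDeriv 2 X`, and
`slope_algebra`). [folklore] -/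
private theorem hasDerivAt_forcedSlip {η α : ℝ} {U X : ℝ → EuclideanSpace ℝ (Fin 3)}
    (hX : ContDiff ℝ 2 X) (hunit : ∀ t, ‖deriv X t‖ = 1)
    (hode : ∀ t, iteratedDeriv 2 X t = η • cross (deriv X t)
      ((1 / 2 : ℝ) • X t - α • cross (EuclideanSpace.single (2 : Fin 3) (1 : ℝ)) (X t) + U t))
    (t : ℝ) :
    HasDerivAt (fun s => ⟪deriv X s,
      (1 / 2 : ℝ) • X s - α • cross (EuclideanSpace.single (2 : Fin 3) (1 : ℝ)) (X s)⟫)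
      (1 / 2 - η * ⟪U t, cross (deriv X t)
        ((1 / 2 : ℝ) • X t - α • cross (EuclideanSpace.single (2 : Fin 3) (1 : ℝ)) (X t))⟫) t := by
  have hXd : Differentiable ℝ X := hX.differentiable (by norm_num)
  have hTd : Differentiable ℝ (deriv X) := hX.differentiable_deriv_two
  have h2 : iteratedDeriv 2 X = deriv (deriv X) := by
    rw [iteratedDeriv_succ, iteratedDeriv_one]
  have hX'' : deriv (deriv X) t = η • cross (deriv X t)
      ((1 / 2 : ℝ) • X t - α • cross (EuclideanSpace.single (2 : Fin 3) (1 : ℝ)) (X t) + U t) := by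
    rw [← h2, hode t]
  have h := (hTd t).hasDerivAt.inner ℝ (hasDerivAt_drift (α := α) (hXd t).hasDerivAt)
  refine h.congr_deriv ?_
  rw [hX'']
  exact slope_algebra η α (deriv X t) (X t) (U t) (hunit t)

/-- Tools stub T6 (`stub_forcedSlopeLaw`): the slope law with forcing. Along a `C²` unit-speed solution of
`X″ = η X′ × (V(X) + U)`, `V y = ½y − α e₃×y`, the drift slip `g = ⟨X′, V(X)⟩` satisfies the EXACT identity
`g′ = ½ − η ⟨U, X′ × V(X)⟩` (so `g′ = ½` where the forcing vanishes — `stub_outerSlopeHalf` — and `|g′ − ½| ≤ η‖U‖‖V(X)‖`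
in general: no spurious far-field stagnation when `η‖U‖‖V(X)‖ < ½`). [folklore] -/
theorem stub_forcedSlopeLaw : ∀ (η α : ℝ) (U : ℝ → EuclideanSpace ℝ (Fin 3)) (X : ℝ → EuclideanSpace ℝ (Fin 3)), ContDiff ℝ 2 X → (∀ t, ‖deriv X t‖ = 1) → (∀ t, iteratedDeriv 2 X t = η • Literature.Analysis.FluidPDE.cross (deriv X t) ((1 / 2 : ℝ) • X t - α • Literature.Analysis.FluidPDE.cross (EuclideanSpace.single (2 : Fin 3) (1 : ℝ)) (X t) + U t)) → ∀ t, deriv (fun s => inner ℝ (deriv X s) ((1 / 2 : ℝ) • X s - α • Literature.Analysis.FluidPDE.cross (EuclideanSpace.single (2 : Fin 3) (1 : ℝ)) (X s))) t = 1 / 2 - η * inner ℝ (U t) (Literature.Analysis.FluidPDE.cross (deriv X t) ((1 / 2 : ℝ) • X t - α • Literature.Analysis.FluidPDE.cross (EuclideanSpace.single (2 : Fin 3) (1 : ℝ)) (X t))) := by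
  intro η α U X hX hunit hode t
  exact (hasDerivAt_forcedSlip hX hunit hode t).deriv

end Summit.NavierStokesRegularity.NavierStokesRegularity.Theorems.SkeletonEquilibrium.Sketch
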